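import Literature.AlgebraicGeometry.Motives.BijectiveMorphismIsoGeneral
import Literature.AlgebraicGeometry.Motives.SepQuotientComparisonComplex
import Mathlib.AlgebraicGeometry.Morphisms.FlatDescent
import HarnessLib

/-!
# Injective on `Ω`-points along ONE embedding `k → Ω = Ω̄` ⇒ universally injective ⇒ injective on points in every field

Topic `AlgebraicGeometry/Motives`; namespace `Literature.AlgebraicGeometry.Motives`.  Theorems only (no definition, no named fact, no instance, no
`sorry`).  For a morphism `f : X ⟶ Y` of `k`-schemes (`k` a field, `X` locally of finite type over `k`, `f` separated) and ONE embedding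
`σ : k →+* Ω` into an algebraically closed field:

* `universallyInjective_left_of_injective_algPoints` — if `f` is injective on `Ω`-valued points (read along `σ`) then `f` is UNIVERSALLY
  INJECTIVE (radicial).  Proof: over `Ω` the base change `f_σ : X_σ ⟶ Y_σ` is injective on `Ω`-points (`AlgPoints.baseChangeEquiv`), hence universally
  injective by ★ `universallyInjective_of_injective` ([StacksProject, Tag 01S4]: injective on `Ω̄`-points with separated `f` ⇒ surjective diagonal);
  `f_σ` is the base change of `f` along the surjective flat quasi-compact projection `Y_σ → Y` (★ `surjective_flat_quasiCompact_fst`), and universal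
  injectivity DESCENDS along fpqc covers (Mathlib `descendsAlong_universallyInjective_surjective_inf_flat_inf_quasicompact`, [StacksProject, Tag 02KW]).
* `algPoints_map_injective_of_injective_algPoints` — hence `f` is injective on `L`-valued points for EVERY field `L` over `k` ([StacksProject, Tag 01S4]
  (1) ⇔ (2)).

Use (cell `hodgecm-mathlib`, crux HLiu418, E-line ED. 5 ∕ P-line ED. 2 pairing, LEAD F0P6-plan (g3) «M-47»∕«M-52»): the E-line exports `sep` = injectivity of
the slice morphism `ε` on COMPLEX points along `τE` (★ `RecordSystemGS.algPoints_map_injective_of_sliceDescent`); the P-line's `ESepAt`∕`stub_INJ` read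
injectivity on `Ω̄_w`-points — this file is the transport.  HC_CM is proved only modulo the 2 remaining named inputs (hLiu418 24832, h413 24833) until
rung 0 closes; count-neutral generic leaf.

## References
* [StacksProject] The Stacks Project, Tag 01S2–01S4 (universally injective = radicial; criterion by points in fields; surjective diagonal),
  Tag 02KW (fpqc descent of «universally injective»).
* [GortzWedhorn2020] U. Görtz, T. Wedhorn, *Algebraic Geometry I* (2nd ed. 2020), Prop. 4.16 (fibre squares), Prop. 14.51 (fpqc descent of properties).
-/

set_option autoImplicit false

universe u

noncomputable section

open CategoryTheory CategoryTheory.Limits AlgebraicGeometry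

namespace Literature.AlgebraicGeometry.Motives

variable {k Ω : Type u} [Field k] [Field Ω] (σ : k →+* Ω) {X Y : SchemeOver k}

/-- `f_σ : X_σ → Y_σ` is the base change of `f` along `Y_σ → Y` (pasting of the squares defining `X_σ`, `Y_σ`; cf. the private twin in ★
`SepQuotientComparisonComplex`). [cite: GortzWedhorn2020, Prop. 4.16] -/
private theorem isPullback_baseChangeHom_map_left_fst (f : X ⟶ Y) :
    IsPullback ((baseChangeHom σ).map f).left (pullback.fst X.hom (Spec.map (CommRingCat.ofHom σ)))
      (pullback.fst Y.hom (Spec.map (CommRingCat.ofHom σ))) f.left := by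
  refine IsPullback.of_right ?_ (baseChangeHom_map_left_comp_fst σ f)
    (IsPullback.of_hasPullback Y.hom (Spec.map (CommRingCat.ofHom σ))).flip
  have h2 : ((baseChangeHom σ).map f).left ≫ pullback.snd Y.hom (Spec.map (CommRingCat.ofHom σ)) =
      pullback.snd X.hom (Spec.map (CommRingCat.ofHom σ)) := pullback.lift_snd _ _ _
  rw [h2, Over.w f]
  exact (IsPullback.of_hasPullback X.hom (Spec.map (CommRingCat.ofHom σ))).flip

/-- Naturality of `X(Ω) ⥲ X_σ(Ω)` (`AlgPoints.baseChangeEquiv`) in the `k`-scheme: `(x ≫ f)_σ = x_σ ≫ f_σ`. [cite: GortzWedhorn2020, Prop. 4.16] -/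
private theorem map_baseChangeHom_map_baseChangeEquiv (f : X ⟶ Y) (x : letI := σ.toAlgebra; AlgPoints X Ω) :
    (letI := σ.toAlgebra
     AlgPoints.map ((baseChangeHom σ).map f) (AlgPoints.baseChangeEquiv σ X x) = AlgPoints.baseChangeEquiv σ Y (AlgPoints.map f x)) := by
  letI : Algebra k Ω := σ.toAlgebra
  symm
  rw [Equiv.apply_eq_iff_eq_symm_apply]
  apply Over.OverMorphism.ext
  rw [AlgPoints.baseChangeEquiv_symm_apply_left, AlgPoints.map_apply, Over.comp_left, AlgPoints.map_apply, Over.comp_left,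
    Category.assoc, baseChangeHom_map_left_comp_fst, ← Category.assoc, AlgPoints.baseChangeEquiv_apply_left_comp_fst]
  rfl

/-- **INJECTIVE ON `Ω̄`-POINTS ALONG ONE EMBEDDING ⇒ UNIVERSALLY INJECTIVE.**  Let `f : X ⟶ Y` be a separated morphism of `k`-schemes, `X` locally of
finite type, and `σ : k → Ω` an embedding into an algebraically closed field.  If `f` is injective on `Ω`-valued points (along `σ`), then `f` is universally
injective: `f_σ` is injective on `Ω`-points of the `Ω`-scheme `X_σ`, hence universally injective (★ `universallyInjective_of_injective`, [StacksProject, Tag 01S4]),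
and universal injectivity descends along the fpqc cover `Y_σ → Y`. [cite: StacksProject, Tag 01S4 and Tag 02KW] [cite: GortzWedhorn2020, Prop. 14.51] -/
theorem universallyInjective_left_of_injective_algPoints [IsAlgClosed Ω] [LocallyOfFiniteType X.hom] (f : X ⟶ Y) [IsSeparated f.left]
    (hinj : letI := σ.toAlgebra; Function.Injective (AlgPoints.map (L := Ω) f)) :
    UniversallyInjective f.left := by
  letI : Algebra k Ω := σ.toAlgebra
  -- the base change over `Ω`
  have hsq := isPullback_baseChangeHom_map_left_fst σ f
  haveI : LocallyOfFiniteType ((baseChangeHom σ).obj X).hom :=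
    MorphismProperty.pullback_snd (P := @LocallyOfFiniteType) _ _ ‹LocallyOfFiniteType X.hom›
  haveI : IsSeparated ((baseChangeHom σ).map f).left :=
    MorphismProperty.of_isPullback (P := @IsSeparated) hsq.flip ‹IsSeparated f.left›
  -- `f_σ` is injective on `Ω`-points
  have hinj' : Function.Injective (AlgPoints.map (L := Ω) ((baseChangeHom σ).map f)) := by
    intro x y hxy
    obtain ⟨x₀, rfl⟩ := (AlgPoints.baseChangeEquiv σ X).surjective x
    obtain ⟨y₀, rfl⟩ := (AlgPoints.baseChangeEquiv σ X).surjective y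
    rw [map_baseChangeHom_map_baseChangeEquiv, map_baseChangeHom_map_baseChangeEquiv] at hxy
    rw [hinj ((AlgPoints.baseChangeEquiv σ Y).injective hxy)]
  have hΩ : UniversallyInjective ((baseChangeHom σ).map f).left := universallyInjective_of_injective _ hinj'
  -- fpqc descent along `Y_σ → Y`
  exact MorphismProperty.of_isPullback_of_descendsAlong (P := @UniversallyInjective)
    (Q := (@Surjective ⊓ @Flat ⊓ @QuasiCompact : MorphismProperty Scheme.{u})) hsq (surjective_flat_quasiCompact_fst σ Y) hΩ

/-- **… hence injective on `L`-valued points for EVERY field `L` over `k`** ([StacksProject, Tag 01S4] (1) ⇒ (2)).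
[cite: StacksProject, Tag 01S4] -/
theorem algPoints_map_injective_of_injective_algPoints [IsAlgClosed Ω] [LocallyOfFiniteType X.hom] (f : X ⟶ Y) [IsSeparated f.left]
    (hinj : letI := σ.toAlgebra; Function.Injective (AlgPoints.map (L := Ω) f))
    (L : Type u) [Field L] [Algebra k L] : Function.Injective (AlgPoints.map (L := L) f) := by
  have hU := universallyInjective_left_of_injective_algPoints σ f hinj
  have h : ∀ (K : Type u) [Field K], Function.Injective (fun g : Spec (.of K) ⟶ X.left ↦ g ≫ f.left) :=
    ((tfae_universallyInjective f.left).out 0 1).mp hU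
  intro x y hxy
  apply Over.OverMorphism.ext
  have hxy' : x.left ≫ f.left = y.left ≫ f.left := by
    rw [← Over.comp_left, ← Over.comp_left, ← AlgPoints.map_apply, ← AlgPoints.map_apply, hxy]
  exact h L hxy'

end Literature.AlgebraicGeometry.Motives

end
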